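import Summits.ValiantsHypothesis.ValiantsHypothesis.Theorems.SymPencilSingSixClassificationPerpPlanes

/-!
# Route `SymPencil` — SING-SIX CLASSIFICATION, Theorem A (T6′): every `6`-dimensional linear
# subspace of `Sing Z(per₄)` lies in a cross, has two zero rows / columns, or is an exotic
# one-zero-line family `V_λ`, `V^gr` (ᵀ) — VERBATIM port, part 7/10 (`--supports`
# stmt-ValiantsHypothesis-5674 `SdcSuperquadratic`; rung currency only, nothing here bears on `VP ≠ VNP`)

PORT NOTE (val-width-5674-w2 g0′, helper mode; director-valiant R223 (a)): part 7/10 of a VERBATIM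
port of val-idea-18 g3/g4's SORRY-FREE Theorem A of `Cruxes/SdcSuperquadratic/Lines/
sing_six_classification.lean` rev 2.6 (sha256 dfb5f805c61d14b7…; here: `E1` … `quad_kill`).
ALL mathematics and proofs are val-idea-18's (memo `SING-SIX-CLASSIFICATION.md`); the port changes
only the file split, the linear import chain, the namespace, and one-line docstrings on API lemmas.
NOT ported: the `sorry`-stubs of LIST leaves 3–5 and `sixDim_perDir_list` (leaves 3, 4 = landed
`SymPencilPerFourExoticNoSixSquares` / `SymPencilPerFourCrossFilter`; leaf 5 open).
  Cut table: see part 1 (`…Defs`).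
Honest label: Theorem A of a line, not the crux, not the LIST; `27 ≤ sdc(per₄) ≤ 29` unchanged; stmt-5674
open; `VP ≠ VNP` not moved; no summit statement is proved here. [folklore]
-/

noncomputable section
set_option linter.dupNamespace false
set_option linter.unusedVariables false
set_option linter.unusedSectionVars false

namespace Summit.ValiantsHypothesis.ValiantsHypothesis.Theorems.SymPencilSingSixClassification

open MvPolynomial Module Literature.Computability.AlgebraicComplexity
open Literature.Barriers.CriticalPhenomena.Haruspicy (fin4_cases)
variable {K : Type*} [Field K]

/-- Vectors supported on the columns `{j, c}`. -/
def E1 (j c : Fin 4) : Submodule K (Fin 4 → K) where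
  carrier := {u | ∀ i, i ≠ j → i ≠ c → u i = 0}
  add_mem' := by
    intro a b ha hb i hij hic
    simp [ha i hij hic, hb i hij hic]
  zero_mem' := by
    intro i _ _
    simp
  smul_mem' := by
    intro r a ha i hij hic
    simp [ha i hij hic]

/-- Auxiliary: `mem_E1` (val-idea-18, SING-SIX classification). [folklore] -/
theorem mem_E1 {j c : Fin 4} {u : Fin 4 → K} :
    u ∈ E1 (K := K) j c ↔ ∀ i, i ≠ j → i ≠ c → u i = 0 := Iff.rfl

/-- A subspace all of whose vectors are supported on (varying) pairs is supported on ONE pair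
(again `Submodule.exists_forall_notMem_of_forall_ne_top`). -/
theorem coordPair_of_cover [CharZero K] (A : Submodule K (Fin 4 → K))
    (h : ∀ a ∈ A, ∃ j c : Fin 4, j ≠ c ∧ ∀ i, i ≠ j → i ≠ c → a i = 0) :
    ∃ j c : Fin 4, j ≠ c ∧ ∀ a ∈ A, ∀ i, i ≠ j → i ≠ c → a i = 0 := by
  by_contra hnone
  have hcov : ∀ j c : Fin 4, ¬ ∀ a ∈ A, ∀ i, i ≠ j → i ≠ c → a i = 0 := by
    intro j c hall
    by_cases hjc : j = c
    · obtain ⟨c', hc'⟩ := exists_ne j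
      exact hnone ⟨j, c', hc'.symm, fun a ha i hij _ => hall a ha i hij (by rw [← hjc]; exact hij)⟩
    · exact hnone ⟨j, c, hjc, hall⟩
  have hne : ∀ jc : Fin 4 × Fin 4, (E1 (K := K) jc.1 jc.2).comap A.subtype ≠ ⊤ := by
    intro jc hjc
    exact hcov jc.1 jc.2 fun a ha => by
      have hmem : (⟨a, ha⟩ : A) ∈ (E1 (K := K) jc.1 jc.2).comap A.subtype := by
        rw [hjc]; exact Submodule.mem_top
      exact hmem
  obtain ⟨x, hx⟩ := Submodule.exists_forall_notMem_of_forall_ne_top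
    (fun jc : Fin 4 × Fin 4 => (E1 (K := K) jc.1 jc.2).comap A.subtype) hne
  obtain ⟨j, c, _, hsup⟩ := h x x.2
  exact hx (j, c) hsup

/-- In a `2`-dimensional `A`, two jointly injective coordinates are jointly surjective. -/
theorem exists_of_inj2 {A : Submodule K (Fin 4 → K)} (hA : finrank K A = 2) {p l : Fin 4}
    (hinj : ∀ a ∈ A, a p = 0 → a l = 0 → a = 0) (c d : K) : ∃ a ∈ A, a p = c ∧ a l = d := by
  obtain ⟨π, hπ_def⟩ : ∃ π : A →ₗ[K] K × K, π =
      ((LinearMap.proj p : (Fin 4 → K) →ₗ[K] K).comp A.subtype).prod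
        ((LinearMap.proj l : (Fin 4 → K) →ₗ[K] K).comp A.subtype) := ⟨_, rfl⟩
  have hπ : ∀ x : A, π x = ((x : Fin 4 → K) p, (x : Fin 4 → K) l) := fun x => by rw [hπ_def]; rfl
  have hπinj : Function.Injective π := by
    intro x y hxy
    rw [hπ, hπ, Prod.mk.injEq] at hxy
    apply Subtype.ext
    have := hinj ((x : Fin 4 → K) - y) (A.sub_mem x.2 y.2)
      (by rw [Pi.sub_apply, hxy.1, sub_self]) (by rw [Pi.sub_apply, hxy.2, sub_self])
    exact sub_eq_zero.mp this
  have hπsurj : Function.Surjective π := by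
    refine (LinearMap.injective_iff_surjective_of_finrank_eq_finrank ?_).mp hπinj
    rw [hA]; simp
  obtain ⟨x, hx⟩ := hπsurj (c, d)
  rw [hπ, Prod.mk.injEq] at hx
  exact ⟨x, x.2, hx.1, hx.2⟩

/-- A linear functional on a `2`-dimensional space has a nonzero kernel vector. -/
theorem exists_ne_zero_ker {A : Submodule K (Fin 4 → K)} (hA : finrank K A = 2)
    (f : A →ₗ[K] K) : ∃ a : A, a ≠ 0 ∧ f a = 0 := by
  have hrn := LinearMap.finrank_range_add_finrank_ker f
  have hr : finrank K (LinearMap.range f) ≤ 1 := by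
    have := Submodule.finrank_le (LinearMap.range f)
    simpa using this
  have hk : LinearMap.ker f ≠ ⊥ := by
    intro hbot
    rw [hbot, hA] at hrn
    simp at hrn
    omega
  obtain ⟨a, ha, hne⟩ := (Submodule.ne_bot_iff _).mp hk
  exact ⟨a, hne, LinearMap.mem_ker.mp ha⟩

/-- Two normalised vectors `x = (…1_p…0_q…)`, `y = (…0_p…1_q…)` in a `2`-dimensional `A`. -/
theorem exists_normalized {A : Submodule K (Fin 4 → K)} (hA : finrank K A = 2) :
    ∃ (p q : Fin 4) (x y : Fin 4 → K), p ≠ q ∧ x ∈ A ∧ y ∈ A ∧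
      x p = 1 ∧ x q = 0 ∧ y p = 0 ∧ y q = 1 := by
  obtain ⟨b₁, hb₁ne, -⟩ := exists_ne_zero_ker hA 0
  obtain ⟨p, hp⟩ : ∃ p, (b₁ : Fin 4 → K) p ≠ 0 := by
    by_contra h
    push Not at h
    exact hb₁ne (Subtype.ext (funext h))
  obtain ⟨b₂, hb₂ne, hb₂p⟩ :=
    exists_ne_zero_ker hA ((LinearMap.proj p : (Fin 4 → K) →ₗ[K] K).comp A.subtype)
  have hb₂p' : (b₂ : Fin 4 → K) p = 0 := hb₂p
  obtain ⟨q, hq⟩ : ∃ q, (b₂ : Fin 4 → K) q ≠ 0 := by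
    by_contra h
    push Not at h
    exact hb₂ne (Subtype.ext (funext h))
  have hpq : p ≠ q := by rintro rfl; exact hq hb₂p'
  refine ⟨p, q, ((b₁ : Fin 4 → K) p)⁻¹ • (b₁ : Fin 4 → K) -
      (((b₁ : Fin 4 → K) p)⁻¹ * (b₁ : Fin 4 → K) q * ((b₂ : Fin 4 → K) q)⁻¹) • (b₂ : Fin 4 → K),
    ((b₂ : Fin 4 → K) q)⁻¹ • (b₂ : Fin 4 → K), hpq, ?_, ?_, ?_, ?_, ?_, ?_⟩
  · exact A.sub_mem (A.smul_mem _ b₁.2) (A.smul_mem _ b₂.2)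
  · exact A.smul_mem _ b₂.2
  · simp [hb₂p', hp]
  · simp [hq]
  · simp [hb₂p']
  · simp [hq]

/-- CASE I of the toric triple: a coordinate vector `e_l ∈ A₃`.  Then `e_l ∈ A₂, A₁` too (the
coordinates `(p, l)` are injective, hence surjective, on the partner plane), all `2 × 2` permanents
off `l` vanish across the three planes, and one vector `x₃ ∈ A₃` with `x₃(l) = 0` pins a second
column `m`: `2 x₃(i) = 0` for `i ∉ {l, m}` (characteristic `≠ 2`), whence everything vanishes off
`{l, m}`. -/
theorem toric_caseI [CharZero K] {A₁ A₂ A₃ : Submodule K (Fin 4 → K)}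
    (hA₁ : finrank K A₁ = 2) (hA₂ : finrank K A₂ = 2) (hA₃ : finrank K A₃ = 2)
    (hT : ∀ a₁ ∈ A₁, ∀ a₂ ∈ A₂, ∀ a₃ ∈ A₃, ∀ l, T3 a₁ a₂ a₃ l = 0) {l : Fin 4}
    (hl3 : (Pi.single l 1 : Fin 4 → K) ∈ A₃) :
    ∃ p q : Fin 4, p ≠ q ∧ (∀ a ∈ A₁, a p = 0 ∧ a q = 0) ∧ (∀ a ∈ A₂, a p = 0 ∧ a q = 0) ∧
      (∀ a ∈ A₃, a p = 0 ∧ a q = 0) := by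
  have H3 : ∀ a₁ ∈ A₁, ∀ a₂ ∈ A₂, ∀ p q, p ≠ q → p ≠ l → q ≠ l → pairPerm a₁ a₂ p q = 0 :=
    fun a₁ h₁ a₂ h₂ p q hpq hpl hql =>
      pairPerm_of_T3_single (fun l' => hT a₁ h₁ a₂ h₂ _ hl3 l') hpq hpl hql
  -- from the permanents off `l` between `B` and `C`: `e_l ∈ C`
  have step : ∀ {B C : Submodule K (Fin 4 → K)}, finrank K B = 2 → finrank K C = 2 →
      (∀ b ∈ B, ∀ c ∈ C, ∀ p q, p ≠ q → p ≠ l → q ≠ l → pairPerm b c p q = 0) →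
      (Pi.single l 1 : Fin 4 → K) ∈ C := by
    intro B C hB hC hBC
    obtain ⟨b, hbne, hbl⟩ :=
      exists_ne_zero_ker hB ((LinearMap.proj l : (Fin 4 → K) →ₗ[K] K).comp B.subtype)
    have hbl' : (b : Fin 4 → K) l = 0 := hbl
    obtain ⟨p, hp⟩ : ∃ p, (b : Fin 4 → K) p ≠ 0 := by
      by_contra h
      push Not at h
      exact hbne (Subtype.ext (funext h))
    have hpl : p ≠ l := by rintro rfl; exact hp hbl'
    have hinj : ∀ c ∈ C, c p = 0 → c l = 0 → c = 0 := by
      intro c hc hcp hcl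
      funext i
      by_cases hip : i = p
      · rw [hip]; exact hcp
      by_cases hil : i = l
      · rw [hil]; exact hcl
      have h := hBC b b.2 c hc p i (Ne.symm hip) hpl hil
      simp only [pairPerm, hcp, mul_zero, add_zero] at h
      exact (mul_eq_zero.mp h).resolve_left hp
    obtain ⟨e, heC, hep, hel⟩ := exists_of_inj2 hC hinj 0 1
    have he : e = Pi.single l 1 := by
      funext i
      by_cases hil : i = l
      · rw [hil, hel]; simp
      by_cases hip : i = p
      · rw [hip, hep]; simp [hpl]
      have h := hBC b b.2 e heC p i (Ne.symm hip) hpl hil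
      simp only [pairPerm, hep, mul_zero, add_zero] at h
      rw [(mul_eq_zero.mp h).resolve_left hp]
      simp [hil]
    rw [← he]
    exact heC
  have hl2 : (Pi.single l 1 : Fin 4 → K) ∈ A₂ := step hA₁ hA₂ H3
  have H2 : ∀ a₁ ∈ A₁, ∀ a₃ ∈ A₃, ∀ p q, p ≠ q → p ≠ l → q ≠ l → pairPerm a₁ a₃ p q = 0 :=
    fun a₁ h₁ a₃ h₃ p q hpq hpl hql =>
      pairPerm_of_T3_single
        (fun l' => by rw [← T3_swap₂₃]; exact hT a₁ h₁ _ hl2 a₃ h₃ l') hpq hpl hql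
  have hl1 : (Pi.single l 1 : Fin 4 → K) ∈ A₁ :=
    step hA₂ hA₁ fun b hb c hc p q hpq hpl hql => by
      rw [pairPerm_comm]; exact H3 c hc b hb p q hpq hpl hql
  have H1 : ∀ a₂ ∈ A₂, ∀ a₃ ∈ A₃, ∀ p q, p ≠ q → p ≠ l → q ≠ l → pairPerm a₂ a₃ p q = 0 :=
    fun a₂ h₂ a₃ h₃ p q hpq hpl hql =>
      pairPerm_of_T3_single
        (fun l' => by rw [T3_swap₁₃, T3_swap₂₃]; exact hT _ hl1 a₂ h₂ a₃ h₃ l') hpq hpl hql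
  -- a vector `x₃ ∈ A₃` with `x₃ l = 0`, and a column `m` with `x₃ m ≠ 0`
  obtain ⟨x₃, hx₃ne, hx₃l⟩ :=
    exists_ne_zero_ker hA₃ ((LinearMap.proj l : (Fin 4 → K) →ₗ[K] K).comp A₃.subtype)
  have hx₃l' : (x₃ : Fin 4 → K) l = 0 := hx₃l
  obtain ⟨m, hm⟩ : ∃ m, (x₃ : Fin 4 → K) m ≠ 0 := by
    by_contra h
    push Not at h
    exact hx₃ne (Subtype.ext (funext h))
  have hml : m ≠ l := by rintro rfl; exact hm hx₃l'
  have hinj1 : ∀ a ∈ A₁, a m = 0 → a l = 0 → a = 0 := by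
    intro a ha ham hal
    funext i
    by_cases him : i = m
    · rw [him]; exact ham
    by_cases hil : i = l
    · rw [hil]; exact hal
    have h := H2 a ha x₃ x₃.2 m i (Ne.symm him) hml hil
    simp only [pairPerm, ham, zero_mul, zero_add] at h
    exact (mul_eq_zero.mp h).resolve_right hm
  have hinj2 : ∀ a ∈ A₂, a m = 0 → a l = 0 → a = 0 := by
    intro a ha ham hal
    funext i
    by_cases him : i = m
    · rw [him]; exact ham
    by_cases hil : i = l
    · rw [hil]; exact hal
    have h := H1 a ha x₃ x₃.2 m i (Ne.symm him) hml hil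
    simp only [pairPerm, ham, zero_mul, zero_add] at h
    exact (mul_eq_zero.mp h).resolve_right hm
  obtain ⟨a₁, ha₁, ha₁m, -⟩ := exists_of_inj2 hA₁ hinj1 1 0
  obtain ⟨a₂, ha₂, ha₂m, -⟩ := exists_of_inj2 hA₂ hinj2 1 0
  -- `x₃` vanishes off `{l, m}` (characteristic `≠ 2`)
  have hx₃ : ∀ i, i ≠ l → i ≠ m → (x₃ : Fin 4 → K) i = 0 := by
    intro i hil him
    have h1 := H2 a₁ ha₁ x₃ x₃.2 m i (Ne.symm him) hml hil
    have h2 := H1 a₂ ha₂ x₃ x₃.2 m i (Ne.symm him) hml hil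
    have h12 := H3 a₁ ha₁ a₂ ha₂ m i (Ne.symm him) hml hil
    simp only [pairPerm, ha₁m, ha₂m, one_mul, mul_one] at h1 h2 h12
    have : (2 : K) * (x₃ : Fin 4 → K) i = 0 := by
      linear_combination h1 + h2 - (x₃ : Fin 4 → K) m * h12
    exact (mul_eq_zero.mp this).resolve_left two_ne_zero
  -- everything vanishes off `{l, m}`
  have hZ1 : ∀ a ∈ A₁, ∀ i, i ≠ l → i ≠ m → a i = 0 := by
    intro a ha i hil him
    have h := H2 a ha x₃ x₃.2 m i (Ne.symm him) hml hil
    rw [pairPerm, hx₃ i hil him, mul_zero, zero_add] at h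
    exact (mul_eq_zero.mp h).resolve_right hm
  have hZ2 : ∀ a ∈ A₂, ∀ i, i ≠ l → i ≠ m → a i = 0 := by
    intro a ha i hil him
    have h := H1 a ha x₃ x₃.2 m i (Ne.symm him) hml hil
    rw [pairPerm, hx₃ i hil him, mul_zero, zero_add] at h
    exact (mul_eq_zero.mp h).resolve_right hm
  have hZ3 : ∀ a ∈ A₃, ∀ i, i ≠ l → i ≠ m → a i = 0 := by
    intro a ha i hil him
    have h := H2 a₁ ha₁ a ha m i (Ne.symm him) hml hil
    rw [pairPerm, ha₁m, hZ1 a₁ ha₁ i hil him, one_mul, zero_mul, add_zero] at h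
    exact h
  -- the two remaining columns
  obtain ⟨γ, hγ0, hγ1⟩ := exists_perm_zero_one hml.symm
  have h2l : γ 2 ≠ l := by rw [← hγ0]; exact fun h => absurd (γ.injective h) (by decide)
  have h2m : γ 2 ≠ m := by rw [← hγ1]; exact fun h => absurd (γ.injective h) (by decide)
  have h3l : γ 3 ≠ l := by rw [← hγ0]; exact fun h => absurd (γ.injective h) (by decide)
  have h3m : γ 3 ≠ m := by rw [← hγ1]; exact fun h => absurd (γ.injective h) (by decide)
  refine ⟨γ 2, γ 3, fun h => absurd (γ.injective h) (by decide), ?_, ?_, ?_⟩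
  · exact fun a ha => ⟨hZ1 a ha _ h2l h2m, hZ1 a ha _ h3l h3m⟩
  · exact fun a ha => ⟨hZ2 a ha _ h2l h2m, hZ2 a ha _ h3l h3m⟩
  · exact fun a ha => ⟨hZ3 a ha _ h2l h2m, hZ3 a ha _ h3l h3m⟩

/-- **§3.8 TORIC TRIPLES — PROVED** (rev 2.5; was `stub_toricTriple`; no `SBShape`).  Normalise
`x = (1_p, 0_q, …)`, `y = (0_p, 1_q, …)` in `A₁`; for `a₃ ∈ A₃` the functional
`a₂ ↦ m_{pq}(a₂, a₃)` on the plane `A₂` has a nonzero kernel vector, which by the KERNEL PAIR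

/-- Auxiliary: ``smallKer`` (val-idea-18, SING-SIX classification). [folklore] -/
lemma `smallKer` is a perpendicular partner of `a₃`; so (`PermOrthPairs`) every `a₃ ∈ A₃` is
supported on a pair, hence (`coordPair_of_cover`) `A₃` on ONE pair `{j, c}`, so `e_j ∈ A₃` and
CASE I (`toric_caseI`) concludes. -/
theorem toricTriple [CharZero K] (hPOP : PermOrthPairs K) : ToricTriple K := by
  intro A₁ A₂ A₃ hA₁ hA₂ hA₃ hT
  obtain ⟨p, q, x, y, hpq, hxA, hyA, hxp, hxq, hyp, hyq⟩ := exists_normalized hA₁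
  have hcover : ∀ a₃ ∈ A₃, ∃ j c : Fin 4, j ≠ c ∧ ∀ i, i ≠ j → i ≠ c → a₃ i = 0 := by
    intro a₃ ha₃
    obtain ⟨f, hf_def⟩ : ∃ f : A₂ →ₗ[K] K, f =
        a₃ q • ((LinearMap.proj p : (Fin 4 → K) →ₗ[K] K).comp A₂.subtype) +
          a₃ p • ((LinearMap.proj q : (Fin 4 → K) →ₗ[K] K).comp A₂.subtype) := ⟨_, rfl⟩
    have hf : ∀ a : A₂, f a = pairPerm (a : Fin 4 → K) a₃ p q := fun a => by
      rw [hf_def]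
      simp only [LinearMap.add_apply, LinearMap.smul_apply, LinearMap.comp_apply,
        Submodule.subtype_apply, LinearMap.proj_apply, smul_eq_mul, pairPerm]
      ring
    obtain ⟨a₂, ha₂ne, hfa₂⟩ := exists_ne_zero_ker hA₂ f
    rw [hf] at hfa₂
    have hperp : PermOrth (a₂ : Fin 4 → K) a₃ :=
      smallKer hpq (a₂ : Fin 4 → K) a₃ x y hxp hxq hyp hyq
        (fun l => hT x hxA a₂ a₂.2 a₃ ha₃ l) (fun l => hT y hyA a₂ a₂.2 a₃ ha₃ l) hfa₂
    rcases hPOP (a₂ : Fin 4 → K) a₃ hperp with h0 | h0 | ⟨j, c, hjc, hsup⟩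
    · exact absurd (Subtype.ext h0) ha₂ne
    · exact ⟨0, 1, by decide, fun i _ _ => by rw [h0]; rfl⟩
    · exact ⟨j, c, hjc, fun i hij hic => (hsup i hij hic).2⟩
  obtain ⟨j, c, hjc, hE⟩ := coordPair_of_cover A₃ hcover
  have hinj3 : ∀ a ∈ A₃, a j = 0 → a c = 0 → a = 0 := by
    intro a ha haj hac
    funext i
    by_cases hij : i = j
    · rw [hij]; exact haj
    by_cases hic : i = c
    · rw [hic]; exact hac
    exact hE a ha i hij hic
  obtain ⟨ej, hejA, hej1, hej0⟩ := exists_of_inj2 hA₃ hinj3 1 0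
  have hej : ej = Pi.single j 1 := by
    funext i
    by_cases hij : i = j
    · rw [hij, hej1]; simp
    by_cases hic : i = c
    · rw [hic, hej0]; simp [Ne.symm hjc]
    rw [hE ej hejA i hij hic]
    simp [hij]
  rw [hej] at hejA
  exact toric_caseI hA₁ hA₂ hA₃ hT hejA

/-! #### Leaf 1 (rev 2.6): the zero-line lemma — Part A + finite union + the anti-block count -/

/-- If `(P ± …)·(ℓ ± c) = 0` along `x ± x₀` with `c ≠ 0`, the quadratic `P` dies (char `≠ 2`). -/
theorem quad_kill [CharZero K] {Px P0 B xab c : K} (hc : c ≠ 0) (e0 : Px * xab = 0) (p0 : P0 = 0)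
    (ep : (Px + B + P0) * (xab + c) = 0) (em : (Px - B + P0) * (xab - c) = 0) : Px = 0 := by
  have h : 2 * c ^ 2 * Px = 0 := by
    linear_combination c * ep - c * em - xab * ep - xab * em + 2 * xab * e0 +
      2 * (xab ^ 2 - c ^ 2) * p0
  rcases mul_eq_zero.mp h with h | h
  · exact absurd (mul_eq_zero.mp h) (by simp [hc])
  · exact h

end Summit.ValiantsHypothesis.ValiantsHypothesis.Theorems.SymPencilSingSixClassification

end
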